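import Summits.ResolutionOfSingularities.ResolutionOfSingularities.Theorems.PurelyInseparableDim4MohAlongBound
import HarnessLib

/-!
# Purely inseparable four-folds — WHEN the shade is constant along an HP-permissible centre: the
# `S`-face criterion (PR-1 (iii)♯)

[OURS · counted 0 · cell `res-dim4-pi`, D-0157 DOOR 2, brick PR-1 (iii)♯; AI work, weaker than expert
review] Nothing here is a statement about resolution of singularities (NOT proved in dimension `≥ 4` /
characteristic `p` anywhere in this programme); census/instrument value only.

Setting of `PurelyInseparableDim4MohAlongBound.lean`: a clean state `s = (F, r, exc)` of order `o`,
shade `d = o − |r|`, a coordinate centre `C_S` satisfying Moh's (3) / HP's (2) at the origin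
(`degIn S e ≥ degIn S r + d` on the support), a point `c` of the centre (`c = 0` on `S`), and the
moved-and-re-cleaned state `s@c = ⟨deletePthPowers p (translate c F), r|_{c=0}, exc|_{c=0}⟩` (written
out). There `shade(s@c) ≥ d` always (`shade_le_shade_translate`) and `>` happens
(`PurelyInseparableDim4MohAlongSpecialPoint.lean`). This file says exactly which monomials of `F`
decide the matter at the points `c` that keep no boundary component outside `S`
(`r_i = 0` whenever `i ∉ S` and `c_i = 0`; every point of the open torus `{c_i ≠ 0 ∀ i ∉ S}` of the
centre, and every point at all when the boundary through the origin lies inside the centre):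

* §1 `coeff_translate_monomial_of_supported` / `coeff_translate_of_supported` — the Taylor
  coefficient of `translate c F` at an exponent `b` SUPPORTED IN `S` is the **face sum**
  `Σ_{D ∈ supp F, D|_S = b} a_D · ∏_{i ∉ S} c_i^{D_i}` (the value at `c` of the polynomial
  `Φ_b = Σ a_D x^{D|_{Sᶜ}}`, non-zero as a polynomial as soon as some `D` has `D|_S = b`).
* §2 `shade_translate_eq_of_faceSum_ne_zero` — **constancy**: if some monomial `D₀` of `F` on the
  `S`-FACE (`degIn S D₀ = degIn S r + d`) has an `S`-exponent prime to `p` and its face sum at `c` is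
  non-zero, then `shade(s@c) = shade(s)`;
  `shade_lt_shade_translate_of_face_dvd` — **jump**: if EVERY monomial of `F` on the `S`-face has all
  its `S`-exponents divisible by `p`, then `shade(s@c) > shade(s)` at EVERY such `c` (witness B of the
  special-point file: `x₀²·x₂`, `S = {0}`, face monomial `x₀²`).
So along the open torus of an HP-permissible centre the shade is either `d` off the hypersurfaces
`Φ_b = 0` (some clean face monomial) or `> d` identically (no clean face monomial); the engines' `+1`
referee on translated edges (`shade_step_le_shade_translate_add_one`) reads `d_c` accordingly.

bears_on: LADDER-RESOLUTION:D157-DOOR2 (res-dim4-pi · PR-1 (iii)♯). Supports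
stmt-ResolutionOfSingularities-16155 (helper).
-/

set_option linter.dupNamespace false

noncomputable section

open MvPolynomial Finset

open scoped BigOperators

namespace Summit.ResolutionOfSingularities.ResolutionOfSingularities.Theorems.PIDim4

open Literature.AlgebraicGeometry.Resolution
open Literature.AlgebraicGeometry.Resolution.Hauser2010
open Literature.AlgebraicGeometry.Resolution.CentreBlowup
open Literature.Barriers.ResolutionOfSingularities

namespace MohAlong

/-! ## 1. Taylor coefficients of the moved polynomial at exponents supported in `S` -/

section FaceSum

variable {σ : Type*} {K : Type*} [Field K] [Fintype σ] [DecidableEq σ]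

/-- **Taylor coefficient of a translated monomial at an exponent supported in `S`** (`c = 0` on `S`,
`b = 0` off `S`): `coeff_b ((y + c)^D) = [D|_S = b|_S] · ∏_{i ∉ S} c_i^{D_i}`. [folklore] -/
theorem coeff_translate_monomial_of_supported {S : Finset σ} (c : σ → K) (hc : ∀ i ∈ S, c i = 0)
    {b : σ →₀ ℕ} (hb : ∀ i, i ∉ S → b i = 0) (D : σ →₀ ℕ) (a : K) :
    coeff b (PointBlowup.translate c (monomial D a)) =
      if (∀ i ∈ S, D i = b i) then a * ∏ i ∈ Sᶜ, c i ^ D i else 0 := by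
  rw [WeightedBlowup.coeff_translate_monomial, ← Finset.prod_mul_prod_compl S]
  have hN : ∏ i ∈ Sᶜ, (((D i).choose (b i) : K) * c i ^ (D i - b i)) = ∏ i ∈ Sᶜ, c i ^ D i :=
    Finset.prod_congr rfl fun i hi => by
      rw [hb i (Finset.mem_compl.mp hi), Nat.choose_zero_right, Nat.cast_one, one_mul, Nat.sub_zero]
  rw [hN]
  split_ifs with h
  · have hS : ∏ i ∈ S, (((D i).choose (b i) : K) * c i ^ (D i - b i)) = 1 :=
      Finset.prod_eq_one fun i hi => by
        rw [h i hi, Nat.choose_self, Nat.cast_one, one_mul, Nat.sub_self, pow_zero]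
    rw [hS, one_mul]
  · push Not at h
    obtain ⟨i, hi, hne⟩ := h
    have hS : ∏ i ∈ S, (((D i).choose (b i) : K) * c i ^ (D i - b i)) = 0 := by
      refine Finset.prod_eq_zero hi ?_
      rcases Nat.lt_or_gt_of_ne hne with hlt | hgt
      · rw [Nat.choose_eq_zero_of_lt hlt, Nat.cast_zero, zero_mul]
      · rw [hc i hi, zero_pow (Nat.sub_ne_zero_of_lt hgt), mul_zero]
    rw [hS, zero_mul, mul_zero]

/-- **The face sum.** The Taylor coefficient of `translate c F` at an exponent `b` supported in `S`
(`c = 0` on `S`) is `Σ_{D ∈ supp F, D|_S = b|_S} a_D · ∏_{i ∉ S} c_i^{D_i}` — the value at `c` of the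
polynomial `Φ_b = Σ_{D|_S = b|_S} a_D · x^{D|_{Sᶜ}}` in the variables off `S`. [folklore] -/
theorem coeff_translate_of_supported {S : Finset σ} (c : σ → K) (hc : ∀ i ∈ S, c i = 0)
    {b : σ →₀ ℕ} (hb : ∀ i, i ∉ S → b i = 0) (F : MvPolynomial σ K) :
    coeff b (PointBlowup.translate c F) =
      ∑ D ∈ F.support with (∀ i ∈ S, D i = b i), coeff D F * ∏ i ∈ Sᶜ, c i ^ D i := by
  rw [PointBlowup.translate_eq_sum_support, coeff_sum, Finset.sum_filter]
  exact Finset.sum_congr rfl fun D _ => coeff_translate_monomial_of_supported c hc hb D _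

omit [Fintype σ] in
/-- The restriction of an exponent to `S` is supported in `S` and agrees with it on `S`. [folklore] -/
theorem filter_mem_apply (S : Finset σ) (D : σ →₀ ℕ) (i : σ) :
    D.filter (fun k => k ∈ S) i = if i ∈ S then D i else 0 :=
  Finsupp.filter_apply _ _ _

/-- The degree of the restriction to `S` is the `S`-degree. [folklore] -/
theorem degree_filter_mem (S : Finset σ) (D : σ →₀ ℕ) :
    (D.filter (fun k => k ∈ S)).degree = degIn S D := by
  rw [Finsupp.degree_eq_sum, degIn]
  simp_rw [filter_mem_apply]
  rw [Finset.sum_ite_mem, Finset.univ_inter]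

end FaceSum

/-! ## 2. The `S`-face criterion -/

section Face

variable {σ : Type*} {K : Type*} [Field K] [Fintype σ] [DecidableEq σ] [DecidableEq K]

omit [Fintype σ] in
/-- At a point of the centre keeping no boundary component outside `S`, the kept multiplicities are
`r|_S`. [folklore] -/
theorem filter_eq_filter_mem {S : Finset σ} (c : σ → K) (hc : ∀ i ∈ S, c i = 0) {r : σ →₀ ℕ}
    (hr0 : ∀ i, i ∉ S → c i = 0 → r i = 0) :
    r.filter (fun i => c i = 0) = r.filter (fun k => k ∈ S) := by
  ext i
  rw [Finsupp.filter_apply, filter_mem_apply]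
  by_cases hi : i ∈ S
  · rw [if_pos (hc i hi), if_pos hi]
  · rw [if_neg hi]
    split_ifs with h0
    · exact hr0 i hi h0
    · rfl

/-- **Constancy of the shade at `c` from a clean face monomial with non-vanishing face sum.** Let
`s = (F, r, exc)` be a state of order `o` with `y^r ∣ F` and `C_S` satisfying HP's (2) at the origin
(`degIn S e ≥ degIn S r + (o − |r|)` on the support); let `c` be a point of the centre (`c = 0` on `S`)
keeping no boundary component outside `S` (`r_i = 0` if `i ∉ S`, `c_i = 0`). If `F` has a monomial
`D₀` ON THE `S`-FACE (`degIn S D₀ = degIn S r + (o − |r|)`) with an `S`-exponent prime to `p` whose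
face sum `Σ_{D|_S = D₀|_S} a_D ∏_{i∉S} c_i^{D_i}` does not vanish at `c`, then the moved-and-re-cleaned
state has the SAME shade as `s`. [folklore] -/
theorem shade_translate_eq_of_faceSum_ne_zero (p : ℕ) {S : Finset σ} (c : σ → K)
    (hc : ∀ i ∈ S, c i = 0) (s : CState σ K) {o : ℕ} (ho : ordZero s.F = o)
    (hr : ∀ d ∈ s.F.support, s.r ≤ d)
    (hperm : ∀ d ∈ s.F.support, degIn S s.r + (o - s.r.degree) ≤ degIn S d)
    (hr0 : ∀ i, i ∉ S → c i = 0 → s.r i = 0)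
    {D₀ : σ →₀ ℕ} (hface : degIn S D₀ = degIn S s.r + (o - s.r.degree))
    {i₀ : σ} (hi₀ : i₀ ∈ S) (hndvd : ¬ p ∣ D₀ i₀)
    (hsum : ∑ D ∈ s.F.support with (∀ i ∈ S, D i = D₀ i), coeff D s.F * ∏ i ∈ Sᶜ, c i ^ D i ≠ 0) :
    CState.shade ⟨deletePthPowers p (PointBlowup.translate c s.F),
      s.r.filter (fun i => c i = 0), s.exc.filter (fun i => c i = 0)⟩ = s.shade := by
  refine le_antisymm ?_ (shade_le_shade_translate p c hc s ho hr hperm)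
  -- the clean face monomial `b = D₀|_S` survives in the moved polynomial
  set b : σ →₀ ℕ := D₀.filter (fun k => k ∈ S) with hb
  have hbN : ∀ i, i ∉ S → b i = 0 := fun i hi => by rw [hb, filter_mem_apply, if_neg hi]
  have hbS : ∀ i ∈ S, b i = D₀ i := fun i hi => by rw [hb, filter_mem_apply, if_pos hi]
  have hcoeff : coeff b (deletePthPowers p (PointBlowup.translate c s.F)) ≠ 0 := by
    rw [coeff_deletePthPowers, if_neg, coeff_translate_of_supported c hc hbN]
    · have : (fun D : σ →₀ ℕ => ∀ i ∈ S, D i = b i) = fun D => ∀ i ∈ S, D i = D₀ i := by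
        funext D
        exact propext ⟨fun h i hi => (h i hi).trans (hbS i hi), fun h i hi => (h i hi).trans (hbS i hi).symm⟩
      simp_rw [this]
      exact hsum
    · intro hP
      exact hndvd (hbS i₀ hi₀ ▸ (isPthPowerExponent_iff p b).mp hP i₀)
  have hord := ordZero_le_of_coeff_ne_zero _ _ hcoeff
  have hbdeg : b.degree = degIn S s.r + (o - s.r.degree) := by rw [hb, degree_filter_mem, hface]
  have hr' : (s.r.filter (fun i => c i = 0)).degree = degIn S s.r := by
    rw [filter_eq_filter_mem c hc hr0, degree_filter_mem]
  rw [CState.shade_eq_of_ordZero_eq s ho]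
  unfold CState.shade
  dsimp only
  rw [hr']
  calc ordZero (deletePthPowers p (PointBlowup.translate c s.F)) - (degIn S s.r : ℕ∞)
      ≤ (b.degree : ℕ∞) - (degIn S s.r : ℕ∞) := tsub_le_tsub_right hord _
    _ = ((o - s.r.degree : ℕ) : ℕ∞) := by rw [hbdeg, ← ENat.coe_sub, Nat.add_sub_cancel_left]

/-- **Jump of the shade at `c` when every face monomial is a `p`-th power in the `S`-variables.**
Same setting (`F` moreover clean and non-zero); if EVERY monomial `D` of `F` on the `S`-face
(`degIn S D = degIn S r + (o − |r|)`) has `p ∣ D_i` for all `i ∈ S`, then at every point `c` of the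
centre keeping no boundary component outside `S` the shade of the moved-and-re-cleaned state is
STRICTLY larger than `shade(s)`: the only candidates for a monomial of degree `|r'| + d` are the face
monomials restricted to `S`, and they are deleted by the cleaning. (Witness B of
`PurelyInseparableDim4MohAlongSpecialPoint.lean`: `x₀²x₂`, `S = {0}`.) [folklore] -/
theorem shade_lt_shade_translate_of_face_dvd (p : ℕ) {S : Finset σ} (c : σ → K)
    (hc : ∀ i ∈ S, c i = 0) (s : CState σ K) (hclean : deletePthPowers p s.F = s.F) (hF : s.F ≠ 0)
    {o : ℕ} (ho : ordZero s.F = o) (hr : ∀ d ∈ s.F.support, s.r ≤ d)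
    (hperm : ∀ d ∈ s.F.support, degIn S s.r + (o - s.r.degree) ≤ degIn S d)
    (hr0 : ∀ i, i ∉ S → c i = 0 → s.r i = 0)
    (hdvd : ∀ D ∈ s.F.support, degIn S D = degIn S s.r + (o - s.r.degree) → ∀ i ∈ S, p ∣ D i) :
    s.shade < CState.shade ⟨deletePthPowers p (PointBlowup.translate c s.F),
      s.r.filter (fun i => c i = 0), s.exc.filter (fun i => c i = 0)⟩ := by
  refine lt_of_le_of_ne (shade_le_shade_translate p c hc s ho hr hperm) fun heq => ?_
  have hMF : deletePthPowers p (PointBlowup.translate c s.F) ≠ 0 := clean_translate_ne_zero p c hclean hF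
  obtain ⟨oM, hoM⟩ := exists_ordZero_eq_natCast hMF
  have hr' : (s.r.filter (fun i => c i = 0)).degree = degIn S s.r := by
    rw [filter_eq_filter_mem c hc hr0, degree_filter_mem]
  -- the order of the moved polynomial is exactly `degIn S r + d`
  have hge := le_ordZero_clean_translate p c hc hr hperm
  rw [hoM, hr'] at hge
  have hge' : degIn S s.r + (o - s.r.degree) ≤ oM := by exact_mod_cast hge
  rw [CState.shade_eq_of_ordZero_eq s ho, CState.shade_eq_of_ordZero_eq _ hoM] at heq
  dsimp only at heq
  rw [hr'] at heq
  have heq' : (o - s.r.degree : ℕ) = oM - degIn S s.r := by exact_mod_cast heq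
  have hoM' : oM = degIn S s.r + (o - s.r.degree) := by omega
  -- an initial monomial of the moved polynomial
  obtain ⟨⟨e, he, hedeg⟩, -⟩ := (ordZero_eq_nat_iff _ _).mp hoM
  have hes : e ∈ (deletePthPowers p (PointBlowup.translate c s.F)).support :=
    MvPolynomial.mem_support_iff.mpr he
  have hnp : ¬ IsPthPowerExponent p e := (mem_support_of_mem_support_deletePthPowers p hes).2
  obtain ⟨D, hD, -, hS⟩ := exists_of_mem_support_clean_translate p c s.F hes
  have hdegS : degIn S e = degIn S D := degIn_eq_of_forall fun i hi => hS i (hc i hi)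
  have hpermD := hperm D hD
  have h1 := degIn_add_sum_compl S e
  -- `e` is supported in `S` and `D` lies on the face
  have hoff : ∑ i ∈ Sᶜ, e i = 0 := by omega
  have hfaceD : degIn S D = degIn S s.r + (o - s.r.degree) := by omega
  apply hnp
  rw [isPthPowerExponent_iff]
  intro i
  by_cases hi : i ∈ S
  · rw [hS i (hc i hi)]
    exact hdvd D hD hfaceD i hi
  · rw [Finset.sum_eq_zero_iff.mp hoff i (Finset.mem_compl.mpr hi)]
    exact dvd_zero p

/-- **Dichotomy on the open torus of the centre, `Perm2`-form.** For a clean presented state with (2)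
at the origin and a point `c` of the centre with ALL off-`S` coordinates non-zero: if every monomial
of `F` on the `S`-face is a `p`-th power in the `S`-variables the shade jumps at `c`. [folklore] -/
theorem shade_lt_shade_translate_of_face_dvd_torus (p : ℕ) {S : Finset σ} (c : σ → K)
    (hc : ∀ i ∈ S, c i = 0) (hcN : ∀ i, i ∉ S → c i ≠ 0) (s : CState σ K)
    (hclean : deletePthPowers p s.F = s.F) (hF : s.F ≠ 0) {o : ℕ} (ho : ordZero s.F = o)
    (hr : ∀ d ∈ s.F.support, s.r ≤ d)
    (hperm : ((degIn S s.r : ℕ) : ℕ∞) + s.shade ≤ ordAlong S s.F)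
    (hdvd : ∀ D ∈ s.F.support, degIn S D = degIn S s.r + (o - s.r.degree) → ∀ i ∈ S, p ∣ D i) :
    s.shade < CState.shade ⟨deletePthPowers p (PointBlowup.translate c s.F),
      s.r.filter (fun i => c i = 0), s.exc.filter (fun i => c i = 0)⟩ :=
  shade_lt_shade_translate_of_face_dvd p c hc s hclean hF ho hr (perm_of_shade_le_ordAlong s ho hperm)
    (fun i hi h0 => absurd h0 (hcN i hi)) hdvd

end Face

end MohAlong

end Summit.ResolutionOfSingularities.ResolutionOfSingularities.Theorems.PIDim4

end
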